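import Summits.CriticalPhenomena.SAWScalingLimit.Theorems.CriticalBubbleBound.Negative.CriticalBubbleBoundLatticeKernel

/-!
# Negative-side results for the crux `SAWTotalPositivity.CriticalBubbleBound` (stmt-CriticalPhenomena-7117):
the fugacity is load-bearing: for every `x > x_c` the statement is FALSE (DKY 2014 Prop. 3 by polygon opening in `𝔻_δ`) (work-file §4).

Refuter `cdisprove` (standing adversary); the full indexed work file is
`Summits/CriticalPhenomena/SAWScalingLimit/Cruxes/CriticalBubbleBound/Disproof.lean`.
-/

noncomputable section

open MeasureTheory Filter Topology Set Function
open Literature.Probability.LatticeModels Literature.Probability.Percolation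
open Literature.Probability.RandomPlanarGeometry Literature.Probability.RandomPlanarGeometry.SAW
open Literature.Barriers.CriticalPhenomena.SupercriticalSAW
open scoped ENNReal NNReal BigOperators

namespace Summit.CriticalPhenomena.SAWScalingLimit.Theorems.CriticalBubbleBound.Negative

open Summit.CriticalPhenomena.SAWScalingLimit.Theses.SAWTotalPositivity (CriticalBubbleBound)

/-! ## §4 Load-bearing analysis: the fugacity `x_c` cannot be raised — FALSE for every `x > x_c` -/

/-- The crux at a general fugacity `x` (weights `x^{|γ|}`, the barrier catalogue's `weightAt x`;
`CriticalBubbleBoundAt x_c` is the crux by `rfl`). -/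
def CriticalBubbleBoundAt (x : ℝ) : Prop :=
  ∃ C : ℝ≥0∞, C ≠ ⊤ ∧ ∀ (Ω : Set ℂ) (δ : ℝ) (u v : Site 2), Bornology.IsBounded Ω → 0 < δ →
    (zdGraph 2).Adj u v → weightAt x Ω δ u v univ ≤ C

/-- At `x = x_c` the parametrised statement is the crux. [folklore] -/
theorem criticalBubbleBoundAt_criticalFugacity :
    CriticalBubbleBoundAt criticalFugacity ↔ CriticalBubbleBound := Iff.rfl

/-- Domains eliminated at every fugacity: `CriticalBubbleBoundAt x ⟺ ∃ C < ∞, ∀ u ∼ v, K_x(u,v) ≤ C`.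
[folklore] -/
theorem criticalBubbleBoundAt_iff_latticeKernel (x : ℝ) :
    CriticalBubbleBoundAt x ↔
      ∃ C : ℝ≥0∞, C ≠ ⊤ ∧ ∀ u v : Site 2, (zdGraph 2).Adj u v → latticeKernel x u v ≤ C := by
  constructor
  · rintro ⟨C, hC, h⟩
    exact ⟨C, hC, fun u v huv => latticeKernel_le_of_forall_unitDisk _ fun δ hδ =>
      h unitDisk δ u v isBounded_unitDisk hδ huv⟩
  · rintro ⟨C, hC, h⟩
    exact ⟨C, hC, fun Ω δ u v _ _ huv => (weightAt_univ_le_latticeKernel x Ω δ u v).trans (h u v huv)⟩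

/-! ### Opening the face polygons of Duminil-Copin–Kozma–Yadin at the south cardinal edge -/

/-- Left endpoint `(m, 0)` of the south cardinal edge of `[0, 2m+1]²`. [cite: DuminilCopinKozmaYadin2014, §2 (definition of P_m)] -/
def southA (m : ℕ) : Site 2 := ![(m : ℤ), 0]

/-- Right endpoint `(m+1, 0)` of the south cardinal edge. [cite: DuminilCopinKozmaYadin2014, §2 (definition of P_m)] -/
def southB (m : ℕ) : Site 2 := ![(m : ℤ) + 1, 0]

/-- The south cardinal edge is a cardinal edge. [cite: DuminilCopinKozmaYadin2014, §2 (definition of P_m)] -/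
theorem south_mem_cardinalEdges (m : ℕ) : s(southA m, southB m) ∈ cardinalEdges m := by
  unfold cardinalEdges southA southB; exact Finset.mem_insert_self _ _

/-- Its endpoints are lattice neighbours. [folklore] -/
theorem southA_adj_southB (m : ℕ) : (zdGraph 2).Adj (southA m) (southB m) := by
  rw [zdGraph_adj_iff]
  refine ⟨0, Or.inl ?_⟩
  funext i; fin_cases i <;> simp [southA, southB]

section Opening

variable {m : ℕ} {E : Finset (Sym2 (Site 2))}

/-- The vertex list of a face polygon opened at the south cardinal edge. [cite: DuminilCopinKozmaYadin2014, §3 (proof of Proposition 7)] -/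
def openedList (m : ℕ) (E : Finset (Sym2 (Site 2))) : List (Site 2) :=
  openList (zdGraph 2) E (southA m) (southB m)

/-- Specification of the opened list of a face polygon. [cite: DuminilCopinKozmaYadin2014, §3 (proof of Proposition 7)] -/
theorem openedList_spec (hE : E ∈ facePolygons m) :
    (openedList m E).IsChain (zdGraph 2).Adj ∧ (openedList m E).Nodup ∧
      (openedList m E).head? = some (southA m) ∧ (openedList m E).getLast? = some (southB m) ∧
      (openedList m E).length = E.card := by
  obtain ⟨-, hpoly, hcard⟩ := mem_facePolygons_iff.1 hE
  have h := openList_spec hpoly (hcard (south_mem_cardinalEdges m))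
  exact ⟨h.1, h.2.1, h.2.2.1, h.2.2.2.1, h.2.2.2.2.1⟩

/-- The opened list is non-empty. [folklore] -/
theorem openedList_ne_nil (hE : E ∈ facePolygons m) : openedList m E ≠ [] := by
  intro h
  have := (openedList_spec hE).2.2.1
  rw [h] at this; simp at this

/-- Every vertex of the opened list lies in the square `[0, 2m+1]²`. [folklore] -/
theorem mem_squareBox_of_mem_openedList (hE : E ∈ facePolygons m) {w : Site 2}
    (hw : w ∈ openedList m E) : w ∈ squareBox m := by
  obtain ⟨hsub, hpoly, hcard⟩ := mem_facePolygons_iff.1 hE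
  obtain ⟨e, he, hwe⟩ := exists_mem_of_mem_openList hpoly (hcard (south_mem_cardinalEdges m)) hw
  exact (mem_edgesIn_iff.1 (hsub he)).2 w hwe

/-- The opened face polygon as a self-avoiding walk of `ℤ²` from `(m,0)` to `(m+1,0)` of length
`#E - 1`. [cite: DuminilCopinKozmaYadin2014, §3 (proof of Proposition 7)] -/
def openedSAW (hE : E ∈ facePolygons m) : LatticeSAW (southA m) (southB m) :=
  ⟨(SimpleGraph.Walk.ofSupport (openedList m E) (openedList_ne_nil hE) (openedList_spec hE).1).copy
      (by
        have h := (openedList_spec hE).2.2.1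
        rw [List.head?_eq_some_head (openedList_ne_nil hE)] at h
        exact Option.some_injective _ h)
      (by
        have h := (openedList_spec hE).2.2.2.1
        rw [List.getLast?_eq_some_getLast (openedList_ne_nil hE)] at h
        exact Option.some_injective _ h),
    by
      rw [SimpleGraph.Walk.isPath_copy, SimpleGraph.Walk.isPath_def, SimpleGraph.Walk.support_ofSupport]
      exact (openedList_spec hE).2.1⟩

/-- The support of the opened SAW is the opened list. [folklore] -/
@[simp] theorem support_openedSAW (hE : E ∈ facePolygons m) :
    (openedSAW hE).1.support = openedList m E := by
  simp [openedSAW]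

/-- The opened SAW has `#E - 1` steps. [folklore] -/
@[simp] theorem length_openedSAW (hE : E ∈ facePolygons m) :
    (openedSAW hE).1.length = E.card - 1 := by
  simp only [openedSAW, SimpleGraph.Walk.length_copy, SimpleGraph.Walk.length_ofSupport]
  rw [(openedList_spec hE).2.2.2.2]

/-- Every vertex of the opened SAW lies in the disk `𝔻_δ`, `δ = δ_{2m+1}`. [folklore] -/
theorem support_openedSAW_mem (hE : E ∈ facePolygons m) :
    ∀ w ∈ (openedSAW hE).1.support, w ∈ meshDomain unitDisk (meshOf (2 * m + 1)) := by
  intro w hw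
  rw [support_openedSAW] at hw
  have hbox := mem_squareBox_iff.1 (mem_squareBox_of_mem_openedList hE hw)
  apply mem_meshDomain_unitDisk_of_abs_le
  intro i
  obtain ⟨h0, h1⟩ := hbox i
  rw [abs_of_nonneg h0]; push_cast; exact h1

/-- The opened face polygon as a SAW of the discretised disk `𝔻_δ`, `δ = δ_{2m+1}`, from `(m,0)`
to `(m+1,0)`. [cite: DuminilCopinKozmaYadin2014, §3 (proof of Proposition 7)] -/
def openedDomainSAW (hE : E ∈ facePolygons m) :
    DomainSAW unitDisk (meshOf (2 * m + 1)) (southA m) (southB m) :=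
  toDisk _ (openedSAW hE) (support_openedSAW_mem hE)

/-- Length bookkeeping: `|γ_E| = #E - 1`. [folklore] -/
@[simp] theorem length_openedDomainSAW (hE : E ∈ facePolygons m) :
    (openedDomainSAW hE).length = E.card - 1 := by
  simp [openedDomainSAW]

/-- Opening is injective on face polygons (the polygon is its opening plus the south edge). [folklore] -/
theorem openedDomainSAW_inj {E E' : Finset (Sym2 (Site 2))} (hE : E ∈ facePolygons m)
    (hE' : E' ∈ facePolygons m) (h : openedDomainSAW hE = openedDomainSAW hE') : E = E' := by
  have h1 : openedSAW hE = openedSAW hE' := toDisk_inj _ _ _ h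
  have h2 := congrArg (fun p : LatticeSAW (southA m) (southB m) => p.1.support) h1
  simp only [support_openedSAW, openedList] at h2
  obtain ⟨-, hpoly, hcard⟩ := mem_facePolygons_iff.1 hE
  obtain ⟨-, hpoly', hcard'⟩ := mem_facePolygons_iff.1 hE'
  exact eq_of_openList_eq hpoly hpoly' (hcard (south_mem_cardinalEdges m))
    (hcard' (south_mem_cardinalEdges m)) h2

end Opening

/-- **Polygon lower bound.** The DKY box partition function is dominated by the disk partition
function between the endpoints of the south cardinal edge: `Z_m(x) ≤ x · Z^x_{𝔻_δ}((m,0),(m+1,0))`,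
`δ = δ_{2m+1}` (open each polygon at the south edge). [cite: DuminilCopinKozmaYadin2014, Proposition 3] -/
theorem Zbox_le_mul_weightAt (m : ℕ) {x : ℝ} (hx : 0 < x)
    (hfin : weightAt x unitDisk (meshOf (2 * m + 1)) (southA m) (southB m) univ ≠ ⊤) :
    Zbox m x ≤ x * (weightAt x unitDisk (meshOf (2 * m + 1)) (southA m) (southB m) univ).toReal := by
  classical
  set δ := meshOf (2 * m + 1)
  -- the opened polygons inject into the SAWs of the disk
  let T : {E // E ∈ facePolygons m} → DomainSAW unitDisk δ (southA m) (southB m) :=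
    fun q => openedDomainSAW q.2
  have hT : ∀ a ∈ (facePolygons m).attach, ∀ b ∈ (facePolygons m).attach, T a = T b → a = b :=
    fun a _ b _ hab => Subtype.ext (openedDomainSAW_inj a.2 b.2 hab)
  have hsum : ∑ E ∈ facePolygons m, ENNReal.ofReal (x ^ (E.card - 1)) ≤
      weightAt x unitDisk δ (southA m) (southB m) univ := by
    calc ∑ E ∈ facePolygons m, ENNReal.ofReal (x ^ (E.card - 1))
        = ∑ q ∈ (facePolygons m).attach, ENNReal.ofReal (x ^ (T q).length) := by
          rw [← Finset.sum_attach]; simp [T]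
      _ = ∑ γ ∈ (facePolygons m).attach.image T, ENNReal.ofReal (x ^ γ.length) :=
          (Finset.sum_image (f := fun γ : DomainSAW unitDisk δ (southA m) (southB m) =>
            ENNReal.ofReal (x ^ γ.length)) hT).symm
      _ ≤ ∑' γ : DomainSAW unitDisk δ (southA m) (southB m), ENNReal.ofReal (x ^ γ.length) :=
          ENNReal.sum_le_tsum _
      _ = weightAt x unitDisk δ (southA m) (southB m) univ := (weightAt_univ x unitDisk δ _ _).symm
  have hreal : ∑ E ∈ facePolygons m, x ^ (E.card - 1) ≤
      (weightAt x unitDisk δ (southA m) (southB m) univ).toReal := by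
    rw [← ENNReal.ofReal_le_iff_le_toReal hfin, ENNReal.ofReal_sum_of_nonneg (fun _ _ => pow_nonneg hx.le _)]
    exact hsum
  have hZ : Zbox m x = x * ∑ E ∈ facePolygons m, x ^ (E.card - 1) := by
    rw [Zbox, Finset.mul_sum]
    refine Finset.sum_congr rfl fun E hE => ?_
    obtain ⟨-, hpoly, hcard⟩ := mem_facePolygons_iff.1 hE
    have h3 := (openList_spec hpoly (hcard (south_mem_cardinalEdges m))).2.2.2.2.2.1
    obtain ⟨k, hk⟩ : ∃ k, E.card = k + 1 := ⟨E.card - 1, by omega⟩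
    rw [hk, pow_succ, Nat.add_sub_cancel]; ring
  rw [hZ]
  exact mul_le_mul_of_nonneg_left hreal hx.le

/-- **THE FUGACITY IS LOAD-BEARING (supercritical side).** For every `x > x_c` the statement
`CriticalBubbleBoundAt x` is FALSE: the disk partition functions between two neighbours are
unbounded (`limsup_m Z_m(x) = ∞`, Duminil-Copin–Kozma–Yadin 2014, Proposition 3, PROVED in the
tree as `DKY2014_prop3_holds`, transported by polygon opening). So any proof of the crux must use
`x = x_c` sharply from above: no argument that is an open condition in the fugacity can work, and
the constant `C(x)` of the subcritical statement (§5) blows up as `x ↑ x_c` is NOT excluded by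
this theorem — the crux asserts exactly that it does not. [cite: DuminilCopinKozmaYadin2014, Proposition 3] -/
theorem not_criticalBubbleBoundAt_of_criticalFugacity_lt {x : ℝ} (hx : criticalFugacity < x) :
    ¬ CriticalBubbleBoundAt x := by
  rintro ⟨C, hC, h⟩
  have hx0 : 0 < x := criticalFugacity_pos_lt_one'.1.trans hx
  obtain ⟨m, hm⟩ := (DKY2014_prop3_holds x hx (x * (C.toReal + 1))).exists
  have hw := h unitDisk (meshOf (2 * m + 1)) (southA m) (southB m) isBounded_unitDisk (meshOf_pos _)
    (southA_adj_southB m)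
  have key := Zbox_le_mul_weightAt m hx0 (ne_top_of_le_ne_top hC hw)
  have hle : (weightAt x unitDisk (meshOf (2 * m + 1)) (southA m) (southB m) univ).toReal ≤ C.toReal :=
    ENNReal.toReal_mono hC hw
  nlinarith

/-- The same in lattice-kernel form: for `x > x_c` the fugacity-`x` nearest-neighbour two-point
function of `ℤ²` is infinite in some direction (`G_x(0,e) = ∞`). [cite: DuminilCopinKozmaYadin2014, Proposition 3] -/
theorem exists_latticeKernel_eq_top_of_criticalFugacity_lt {x : ℝ} (hx : criticalFugacity < x) :
    ∃ e : Site 2, (zdGraph 2).Adj 0 e ∧ latticeKernel x 0 e = ⊤ := by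
  by_contra hcon
  push Not at hcon
  apply not_criticalBubbleBoundAt_of_criticalFugacity_lt hx
  rw [criticalBubbleBoundAt_iff_latticeKernel]
  classical
  let U : Finset (Site 2) := {Pi.single 0 1, -Pi.single 0 1, Pi.single 1 1, -Pi.single 1 1}
  have hU : ∀ e : Site 2, (zdGraph 2).Adj 0 e → e ∈ U := by
    intro e he
    obtain ⟨i, hi | hi⟩ := (zdGraph_adj_iff _ _).1 he
    · rw [zero_add] at hi; subst hi
      fin_cases i <;> simp [U]
    · have : e = -Pi.single i 1 := eq_neg_of_add_eq_zero_left hi.symm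
      subst this
      fin_cases i <;> simp [U]
  refine ⟨∑ e ∈ U, (if (zdGraph 2).Adj 0 e then latticeKernel x 0 e else 0), ?_, fun u v huv => ?_⟩
  · rw [ENNReal.sum_ne_top]
    intro e _
    split_ifs with he
    · exact hcon e he
    · exact ENNReal.zero_ne_top
  · have hadj : (zdGraph 2).Adj 0 (v - u) := by
      have := (Zd.zdGraph_adj_sub_right u v u).2 huv
      rwa [sub_self] at this
    rw [latticeKernel_eq_zero_sub]
    calc latticeKernel x 0 (v - u) = (if (zdGraph 2).Adj 0 (v - u) then latticeKernel x 0 (v - u) else 0) := by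
          rw [if_pos hadj]
      _ ≤ ∑ e ∈ U, (if (zdGraph 2).Adj 0 e then latticeKernel x 0 e else 0) :=
          Finset.single_le_sum (f := fun e => if (zdGraph 2).Adj 0 e then latticeKernel x 0 e else 0)
            (fun _ _ => zero_le) (hU _ hadj)

end Summit.CriticalPhenomena.SAWScalingLimit.Theorems.CriticalBubbleBound.Negative
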